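import Summits.QuantumFields.YangMills.Theorems.BalabanUVNodesN18AtRateRecord13RunTowers
import Literature.MathematicalPhysics.QuantumFieldTheory.Balaban1983to89.Node00.HistoryRecursionOfRecord
import Summits.QuantumFields.YangMills.Theorems.BalabanUVNodesN18AtReadingOfRecord13Sep

/-!
# ⁗ (SEPARATION-GUARD) EDITION of `BalabanUVNodesN18AtRateRecord13RunTowers` (p?18f) — seat pub-ymgap-dag-n18-d (N18 = NE5, strategy s2), RE-KEYED on def-T's `Stage13Params.Provisos₁₃Sep` ∕
# `Node00.datumOfRecord₁₃Sep` (`Node00/Record13` v1.2, p501191), RR-2's datum key `Node00.IsDatumOfRecord₁₃CSep` (`Node00/Record13DatumKeySep`, p502881) and dag-n22-e's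
# (T-RATE) layer-B ⁗ homes (`RateReading₁₃Sep`, `RRec₁₃Sep`, `RRec₁₃SepOn`, `readingOfRecord₁₃Sep`, `s_N18_rRec₁₃Sep(On)_iff`, `forall_datumKey₁₃Sep_of_forall_admissible`, `readingOfRecord₁₃Sep_u3`)
#
# WHY (route `route-QuantumFields-BalabanUVNodes` rev 18∕19; director-ym №136–№140, plan g67 KEY-18, dag-lead WORDS-139∕140): print ([Balaban1989LargeFieldII] Thm 1) gives the
# background row only at SEPARATED (2.18)-sequences; def-T ADDED the print-faithful proviso `Provisos₁₃Sep` (deprecate-and-add), the four cruxes were re-minted over it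
# (K3⁗ `SpineGivenEndpointR13Sep` = stmt-QuantumFields-20292), and a theorem binding the OLD proviso cannot be fed from the weaker new one — so every storey typed
# `∀ θ (hP : θ.Provisos₁₃ F N), …` is re-keyed ONCE.  THIS FILE is the twin of this seat's own ‴ module under the token map `Provisos₁₃ ↦ Provisos₁₃Sep` ·
# `datumOfRecord₁₃ ↦ datumOfRecord₁₃Sep` · `IsDatumOfRecord₁₃C ↦ IsDatumOfRecord₁₃CSep` · `RateReading₁₃ ↦ RateReading₁₃Sep` · `RRec₁₃ ↦ RRec₁₃Sep` · `RRec₁₃On ↦ RRec₁₃SepOn` ·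
# `readingOfRecord₁₃ ↦ readingOfRecord₁₃Sep` · `s_N18_rRec₁₃(On)_iff ↦ s_N18_rRec₁₃Sep(On)_iff` · `forall_datumKey₁₃_of_forall_admissible ↦ forall_datumKey₁₃Sep_of_forall_admissible`, and in
# THIS seat's decl names `rRec₁₃ ↦ rRec₁₃Sep`, `readingOfRecord₁₃ ↦ readingOfRecord₁₃Sep`; statements = the ‴ statements under the map, proofs = the ‴ proofs VERBATIM.
# EVERYTHING θ-LEVEL IS UNCHANGED AND NOT RE-DECLARED (`Stage13Params`, `u3OfRecord₁₃`, the per-tuple faces and junctions of the original carry no proviso ∕ key and are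
# IMPORTED BY NAME — this module imports its ‴ original) — here: `n18At_u3OfRecord₁₃_readingAdm_runTowers_iff_le`.
# ITEM IDS quoted in the ‴ header below (K3‴ `SpineGivenEndpointR13`, stmt-QuantumFields-19912; K0‴) are ASIDES after rev 18; this file is filed
# `--kind proof --supports stmt-QuantumFields-20292 --as helper` — COUNT-NEUTRAL, no stub closed, N18 NOT discharged, no inhabitant of any ⁗ key claimed (K0⁗ `Record13SepInhabited` OPEN).
#
# ‴ HEADER OF RECORD FOLLOWS (token-mapped; its decl list is this file's, the θ-only names above excepted):
#
# BalabanUVNodes ∕ node N18 = NE5 — N18 AT THE STAGE-13 HOMES FOR THE RUN TOWERS `runTowers S′`: the statement of record compares the runs' terms at the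
# creation steps `j ≤ k` only — per tuple, at the unguarded home and at the regime-restricted home
# (Track A, DAG node N18 = `T4OutputRate.NE5` :211; cluster K4 «SpineRates», item K3⁗ `SpineGivenEndpointR13Sep` ∕ K3‴; module 18f of seat pub-ymgap-dag-n18-d, strategy s2)

HONEST FRAMING.  Count-neutral kernel bookkeeping (`--supports … --as helper`), composition BY NAME of landed theorems; NE5 is NOT PRINTED and NOT proved;
N18 is NOT discharged; no inhabitant of `IsDatumOfRecord₁₃CSep` is claimed (K0 OPEN); the towers `S′` stay a PARAMETER.

WHY.  [I] (0.23)–(0.24): the run of `k` renormalization steps on the `k`-th torus creates the terms of creation steps `j = 1, …, k` and no others; node00-def-W1's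
`Node00/HistoryRecursionOfRecord` §1 types this as `runTowers S′ k := truncRun k (S′ k)` (steps `m < k` kept, steps `m ≥ k` TERMLESS) with
`functionalC_truncRun_of_le` ∕ `functionalC_truncRun_eq_zero`.  Module 17 (`…N18AtRunTowers`, p494645) read N18's ₁₂ statement of record at the run towers
(«⇔ the creation steps `j ≤ k` of the untruncated towers»); modules 18 ∕ 18b typed the Stage-13 homes for any pinned reading; dag-n27-c's XLII and dag-n22-e's
8b″ read the admissible Stage-13 reading AT RUN TOWERS (`runTowers (k ↦ toClusterTower (G F θ k))`).  THIS FILE is module 17 §1 at the Stage-13 homes: per tuple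
and run length (§1: `N18At` at the Stage-13 bundle of `ReadingData.ofRecordAdm … (runTowers S′) …` ⇔ the η-rate inequality for the UNTRUNCATED towers `S′ k ∕ S′
(k+1)` at the run-A domains of creation step `j ≤ k`, under the sign letters `0 ≤ C₅`, `0 ≤ θ₅` — the domains of creation step `j > k` compare `0` with `0`),
and the closed forms of `S_N18 (RRec₁₃Sep 𝔯)` ∕ `S_N18 (RRec₁₃SepOn 𝔯 Rg)` for any reading pinned to that family (§2: module 18's `s_N18_rRec₁₃Sep_iff_of_pin` route and
layer B's `s_N18_rRec₁₃SepOn_iff` + §1) — `k + 1` levels per run length, the honest display of what the statement at the run towers asks.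

WHAT (all `theorem`, 0 `def`).  §1 `n18At_u3OfRecord₁₃_readingAdm_runTowers_iff_le`.  §2 ★ `s_N18_rRec₁₃Sep_readingAdm_runTowers_iff_le_of_pin` (unguarded home),
★ `s_N18_rRec₁₃SepOn_readingAdm_runTowers_iff_le_of_pin` (regime home).

One finite four-torus programme at fixed `ε`; NOT the continuum limit, NOT OS, NOT a mass gap, NOT Clay.  0 `def`, 0 `sorry`.  Sources (TYPES only): T. Bałaban,
CMP **109** (1987) [Balaban1987RG1] (0.23)–(0.25) pp. 256–257, Thm 1 p. 259, (1.18) p. 263; CMP **116** (1988) [Balaban1988RG2Cluster] (2.13) p. 14, (2.16)–(2.18)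
p. 16; CMP **122** (1989) [Balaban1989LargeFieldII] (the record's stage).
-/

noncomputable section

open Set Metric
open scoped Matrix.Norms.L2Operator

namespace YMDAG.N18.W1Reading

open Literature.MathematicalPhysics.QuantumFieldTheory.Balaban1983to89
open Literature.MathematicalPhysics.QuantumFieldTheory.Balaban1983to89.T4Continuum
open Literature.MathematicalPhysics.QuantumFieldTheory.Balaban1983to89.T4OutputRate (Carriers Functional NE5 DecayBound Window)
open Literature.MathematicalPhysics.QuantumFieldTheory.Balaban1983to89.Node00 (Stage12Params Stage13Params IsDatumOfRecord₁₃CSep datumOfRecord₁₃Sep U3Letters₁₁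
  U3Objects₁₁ NE2Objects₁₁ NE3Letters₁₁ prependCoupling MatA ιSU avOfRecord)
open Literature.MathematicalPhysics.QuantumFieldTheory.Balaban1983to89.Node00.Sect2 (domCount domSys CPair ofBackgroundC)
open Literature.MathematicalPhysics.QuantumFieldTheory.Balaban1983to89.Node00.W1 (ReadingData LevelPairing LetterInputs ClusterTower pairOfRecord
  dj_pairOfRecord functionalC functional box SpRestr truncRun runTowers termlessTower functionalC_truncRun_of_le functionalC_truncRun_eq_zero)
open Summit.QuantumFields.BalabanUV.T4Continuum.B13Carriers (transportRaw)
open Summit.QuantumFields.BalabanUV.T4Continuum.Spine.NE5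
open YMDAG.N18.HLayer
open YMDAG.UVSplit

variable {N : ℕ} [NeZero N]


/-! ## §2 The closed forms at the Stage-13 homes for a reading pinned to the admissible reading at run towers -/

section Pinned

variable (𝔯 : RateReading₁₃Sep N) (Rg : (F : T4Family) → Stage13Params F N → Prop)
  (S' : (F : T4Family) → (θ : Stage13Params F N) → (k : ℕ) → ClusterTower (F.P k) (MatA N) θ.τ9.M)
  (sp : (F : T4Family) → (θ : Stage13Params F N) → (k j : ℕ) → (domSys (F.P k) θ.τ9.M j).Dom → Set (CPair (F.P k) (MatA N)))
  (gauge : (F : T4Family) → (θ : Stage13Params F N) → (k : ℕ) → GaugeField (F.P k) 0 (Node00.SU N) → GaugeField (F.P k) 0 (Node00.SU N) → ℝ)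
  (hg : ∀ (F : T4Family) (θ : Stage13Params F N) (k : ℕ) (U U' : GaugeField (F.P k) 0 (Node00.SU N)), 0 ≤ gauge F θ k U U')
  (T₀ : (F : T4Family) → (θ : Stage13Params F N) → (k : ℕ) → GaugeField (F.P (k + 1)) 0 (Node00.SU N) → GaugeField (F.P k) 0 (Node00.SU N))
  (hT : ∀ (F : T4Family) (θ : Stage13Params F N) (k : ℕ) (U : GaugeField (F.P (k + 1)) 0 (Node00.SU N)),
    (∀ (j : ℕ) (Y : (domSys (F.P (k + 1)) θ.τ9.M j).Dom), ofBackgroundC (ιSU N) U ∈ sp F θ (k + 1) j Y) →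
      ∀ (j : ℕ) (X : (domSys (F.P k) θ.τ9.M j).Dom), ofBackgroundC (ιSU N) (T₀ F θ k U) ∈ sp F θ k j X)
  (li : (F : T4Family) → Stage13Params F N → LetterInputs)
  (hpin : ∀ (F : T4Family) (θ : Stage13Params F N) (hP : θ.Provisos₁₃Sep F N) (g₀ : ℕ → ℝ) (os : List (ULoop F)),
    (𝔯.lit F θ hP g₀ os).u3 =
      (ReadingData.ofRecordAdm F θ.τ9.M N (runTowers (S' F θ)) (sp F θ) (gauge F θ) (hg F θ) (T₀ F θ) (hT F θ) (li F θ)).u3Objects θ.γ)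
  (hC₅ : ∀ (F : T4Family) (θ : Stage13Params F N), 0 ≤ (li F θ).C₅) (hθ₅ : ∀ (F : T4Family) (θ : Stage13Params F N), 0 ≤ (li F θ).θ₅)

include hpin hC₅ hθ₅ in
/-- ★ **N18's STATEMENT OF RECORD AT THE STAGE-13 HOME FOR A READING PINNED TO THE ADMISSIBLE READING AT RUN TOWERS = THE CREATION STEPS `j ≤ k` OF THE UNTRUNCATED
TOWERS** [bookkeeping; layer B's `s_N18_rRec₁₃Sep_iff` + `hpin` + §1].  Under the sign letters: `S_N18 (RRec₁₃Sep 𝔯)` ⇔ for every family `F`, datum of record `D` with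
Stage-13 key `h` (`θ := h.params`), run length `k`, member `b ∈ ]0, θ.γ]`, history `g ∈ ]0, θ.γ]^ℕ`, ADMISSIBLE run-B field `U` of the `(k+1)`-th torus and every
run-A domain `(j, X)` WITH `j ≤ k`: `|Re E^{(j)}_{S′_k}(X; g; (ι(T₀ U), 0)) − Re E^{(j+1)}_{S′_{k+1}}(πX; b∷g; (ιU, 0))| ≤ C₅ · θ₅ ^ j · e^{−κ·d_j(X)}` — `k + 1` levels per
run length.  The ₁₃ twin of module 17 §1 `s_N18_readingAdm₁₂_runTowers_iff`.  NOT PRINTED; NOT proved. [cite: Balaban1987RG1, (0.23)–(0.25) pp.256–257, Thm 1 p.259 and (1.18) p.263; Balaban1988RG2Cluster, (2.13) p.14 and (2.16)–(2.18) p.16] -/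
theorem s_N18_rRec₁₃Sep_readingAdm_runTowers_iff_le_of_pin :
    S_N18 (RRec₁₃Sep 𝔯) ↔
      ∀ (F : T4Family) (D : Datum F N) (h : IsDatumOfRecord₁₃CSep F N D) (k : ℕ) (b : ℝ), 0 < b → b ≤ h.params.γ →
        ∀ g ∈ Window h.params.γ,
          ∀ (U : {U : GaugeField (F.P (k + 1)) 0 (Node00.SU N) //
              ∀ (j : ℕ) (Y : (domSys (F.P (k + 1)) h.params.τ9.M j).Dom), ofBackgroundC (ιSU N) U ∈ sp F h.params (k + 1) j Y})
            (X : Node00.W1.Dom (F.P k) h.params.τ9.M), X.1 ≤ k →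
          |(functionalC (S' F h.params k) g (ofBackgroundC (ιSU N) (T₀ F h.params k U.1)) X).re -
              (functionalC (S' F h.params (k + 1)) (prependCoupling b g) (ofBackgroundC (ιSU N) U.1) (pairOfRecord F h.params.τ9.M k X)).re| ≤
            (li F h.params).C₅ * (li F h.params).θ₅ ^ X.1 * Real.exp (-((li F h.params).κ * (domSys (F.P k) h.params.τ9.M X.1).dj X.2)) := by
  rw [s_N18_rRec₁₃Sep_iff]
  constructor
  · intro H F D h k
    have h₁ := H F D h (fun _ => 0) [] k
    rw [hpin] at h₁
    exact (n18At_u3OfRecord₁₃_readingAdm_runTowers_iff_le h.params k (S' F h.params) (sp F h.params) (gauge F h.params) (hg F h.params) (T₀ F h.params)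
      (hT F h.params) (li F h.params) (hC₅ F h.params) (hθ₅ F h.params)).1 h₁
  · intro H F D h g₀ os k
    rw [hpin]
    exact (n18At_u3OfRecord₁₃_readingAdm_runTowers_iff_le h.params k (S' F h.params) (sp F h.params) (gauge F h.params) (hg F h.params) (T₀ F h.params)
      (hT F h.params) (li F h.params) (hC₅ F h.params) (hθ₅ F h.params)).2 (H F D h k)

include hpin hC₅ hθ₅ in
/-- ★ **THE SAME AT THE REGIME-RESTRICTED HOME** [bookkeeping; layer B's `s_N18_rRec₁₃SepOn_iff` + `hpin` + §1]: `S_N18 (RRec₁₃SepOn 𝔯 Rg)` ⇔ the inequality of the previous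
result, asked at every Stage-13 tuple `θ` with `Provisos₁₃Sep` IN `Rg`, admissible (the θ-keyed form of layer B's regime home), every run length `k`, member, history,
admissible run-B field and run-A domain of creation step `j ≤ k`. [cite: Balaban1987RG1, (0.23)–(0.25) pp.256–257, Thm 1 p.259 and (1.18) p.263; Balaban1988RG2Cluster, (2.13) p.14] -/
theorem s_N18_rRec₁₃SepOn_readingAdm_runTowers_iff_le_of_pin :
    S_N18 (RRec₁₃SepOn 𝔯 Rg) ↔
      ∀ (F : T4Family) (θ : Stage13Params F N), θ.Provisos₁₃Sep F N → Rg F θ → θ.Admissible F N → ∀ (k : ℕ) (b : ℝ), 0 < b → b ≤ θ.γ →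
        ∀ g ∈ Window θ.γ,
          ∀ (U : {U : GaugeField (F.P (k + 1)) 0 (Node00.SU N) // ∀ (j : ℕ) (Y : (domSys (F.P (k + 1)) θ.τ9.M j).Dom), ofBackgroundC (ιSU N) U ∈ sp F θ (k + 1) j Y})
            (X : Node00.W1.Dom (F.P k) θ.τ9.M), X.1 ≤ k →
          |(functionalC (S' F θ k) g (ofBackgroundC (ιSU N) (T₀ F θ k U.1)) X).re -
              (functionalC (S' F θ (k + 1)) (prependCoupling b g) (ofBackgroundC (ιSU N) U.1) (pairOfRecord F θ.τ9.M k X)).re| ≤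
            (li F θ).C₅ * (li F θ).θ₅ ^ X.1 * Real.exp (-((li F θ).κ * (domSys (F.P k) θ.τ9.M X.1).dj X.2)) := by
  rw [s_N18_rRec₁₃SepOn_iff]
  constructor
  · intro H F θ hP hRg hA k
    have h₁ := H F θ hP hRg hA (fun _ => 0) [] k
    rw [hpin] at h₁
    exact (n18At_u3OfRecord₁₃_readingAdm_runTowers_iff_le θ k (S' F θ) (sp F θ) (gauge F θ) (hg F θ) (T₀ F θ) (hT F θ) (li F θ) (hC₅ F θ) (hθ₅ F θ)).1 h₁
  · intro H F θ hP hRg hA g₀ os k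
    rw [hpin]
    exact (n18At_u3OfRecord₁₃_readingAdm_runTowers_iff_le θ k (S' F θ) (sp F θ) (gauge F θ) (hg F θ) (T₀ F θ) (hT F θ) (li F θ) (hC₅ F θ) (hθ₅ F θ)).2
      (H F θ hP hRg hA k)

end Pinned

end YMDAG.N18.W1Reading

end
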